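import Summits.ResolutionOfSingularities.ResolutionOfSingularities.Theorems.FrobeniusClosingPatchingRelPerfectMonomialPolyhedraGame
import Mathlib.Order.WellFoundedSet
import HarnessLib

/-!
# Crux `PatchingRelPerfect` (stmt-ResolutionOfSingularities-16161), chain w52 — TargetsF3 (m)
# «M2-strong», COMBINATORIAL HALF, file 2: GLOBALISATION — a local upper-semicontinuous
# invariant package wins the global permissible polyhedra game

[OURS · L1 W5.2 · res-L1-w52-plan-1 RULING M2 2026-08-27T06:34:44Z; fact-free; nothing here is a
statement of the manuscript under review]

The local polyhedra game (one closed stratum, player 2 choosing charts) does NOT by itself win the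
global solitaire of file 1: charts overlap, and a centre chosen in one chart is a blow-up in every
chart containing it.  Resolution algorithms globalise through a CANONICAL invariant: an upper
semicontinuous, well-ordered local invariant whose maximum locus is a disjoint union of permissible
strata and drops after blowing them up (Bierstone–Milman's `inv`, Villamayor's, Encinas–Hauser's
mobiles; for monomial ideals Spivakovsky's `τ_S`).  This file isolates that architecture ONCE,
abstractly, for the chart-free game of file 1:

* `InvariantPackage W` — `inv : State → Finset ℕ → W` (value at the stratum `T`), `ctr` (the stratum
  of the locus `{inv = inv T}` through the point-type `T`), with the axioms MONOTONE (usc), CENTRE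
  (`ctr s T ⊆ T`, permissible, same `inv`), COHERENT (nested point-types with equal `inv` have the same
  centre), UNCHANGED (strata away from the exceptional index keep `inv` and `ctr`), DROP (after blowing
  up the centre of a maximal non-principal stratum, every new non-principal stratum has smaller `inv`);
* `InvariantPackage.winnable` — **every well-formed state is `Winnable 0`**: blow up the centre of a
  maximal non-principal stratum; either the maximum drops (well-foundedness of `W`) or the finite set
  of maximal centres loses that centre and gains none.

Hence `GlobalPermissiblePolyhedraGame` follows from ANY instance of `InvariantPackage` (file 3+:
Spivakovsky 1983 ≙ Bierstone–Milman specialised to monomial marked ideals, characteristic-free).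
-/

-- `Summit.<Summit>.<Sub>.Theorems` with `Sub = Summit` (single-conjunct summit, D-0017)
set_option linter.dupNamespace false

namespace Summit.ResolutionOfSingularities.ResolutionOfSingularities.Theorems

namespace PolyhedraGame

open Finset

/-! ## Strata away from the exceptional index are untouched by a move -/

/-- [OURS] A stratum of the moved state not containing the exceptional index is an old stratum not
containing the centre. -/
theorem mem_str_of_mem_move_str_of_not_mem {s : State} {J : Finset ℕ} {e c : ℕ} {T : Finset ℕ}
    (hT : T ∈ (move s J e c).Str) (heT : e ∉ T) : T ∈ s.Str ∧ ¬ J ⊆ T := by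
  rcases mem_moveStrata_iff.mp hT with h | ⟨T₀, -, -, -, rfl⟩
  · exact h
  · exact absurd (Finset.mem_insert_self e T₀) heT

/-- [OURS] An old stratum not containing the centre survives the move. -/
theorem mem_move_str_of_mem_str {s : State} {J : Finset ℕ} (e c : ℕ) {T : Finset ℕ}
    (hT : T ∈ s.Str) (hJT : ¬ J ⊆ T) : T ∈ (move s J e c).Str :=
  mem_moveStrata_iff.mpr (Or.inl ⟨hT, hJT⟩)

/-- [OURS] Principality at a stratum away from the (fresh) exceptional index is unchanged by a move:
the restricted exponent vectors are the same. -/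
theorem principalAt_move_iff {s : State} {J : Finset ℕ} {e c : ℕ}
    {T : Finset ℕ} (heT : e ∉ T) : PrincipalAt (move s J e c) T ↔ PrincipalAt s T := by
  have key : ∀ α : ℕ →₀ ℕ, ∀ i ∈ T, moveExp J e c α i = α i := fun α i hi =>
    moveExp_apply_of_ne α (fun h => heT (h ▸ hi))
  constructor
  · rintro ⟨β₀, hβ₀, hmin⟩
    obtain ⟨α₀, hα₀, rfl⟩ := Finset.mem_image.mp hβ₀
    refine ⟨α₀, hα₀, fun α hα i hi => ?_⟩
    have := hmin (moveExp J e c α) (Finset.mem_image_of_mem _ hα) i hi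
    rwa [key α₀ i hi, key α i hi] at this
  · rintro ⟨α₀, hα₀, hmin⟩
    refine ⟨moveExp J e c α₀, Finset.mem_image_of_mem _ hα₀, fun β hβ i hi => ?_⟩
    obtain ⟨α, hα, rfl⟩ := Finset.mem_image.mp hβ
    rw [key α₀ i hi, key α i hi]
    exact hmin α hα i hi

/-- [OURS] Principality descends to faces. -/
theorem PrincipalAt.mono {s : State} {T T' : Finset ℕ} (h : PrincipalAt s T') (hTT' : T ⊆ T') :
    PrincipalAt s T := by
  obtain ⟨α₀, hα₀, hmin⟩ := h
  exact ⟨α₀, hα₀, fun α hα i hi => hmin α hα i (hTT' hi)⟩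

/-! ## The invariant package -/

/-- [OURS · W5.2 M2-strong] A LOCAL UPPER-SEMICONTINUOUS INVARIANT PACKAGE for the global permissible
polyhedra game, with values in a linear order `W`: the abstract form of a canonical resolution
invariant (Bierstone–Milman `inv` / Spivakovsky `τ_S`) restricted to monomial ideals.  `inv s T` is the
value at the point-type `T`; `ctr s T` indexes the stratum of the locus `{inv = inv s T}` through that
point.  Only NON-principal strata matter. -/
structure InvariantPackage (W : Type*) [LinearOrder W] where
  /-- the invariant at a stratum (point-type) -/
  inv : State → Finset ℕ → W
  /-- the centre through a non-principal point-type: the stratum of `{inv = inv s T}` at `T` -/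
  ctr : State → Finset ℕ → Finset ℕ
  /-- upper semicontinuity: specialisation does not decrease the invariant -/
  mono : ∀ s : State, s.WF → ∀ T' ∈ s.Str, ∀ T, T ⊆ T' → inv s T ≤ inv s T'
  /-- the centre passes through the point -/
  ctr_subset : ∀ s : State, s.WF → ∀ T ∈ s.Str, ¬ PrincipalAt s T → ctr s T ⊆ T
  /-- the centre is a permissible stratum (inside the cosupport) -/
  ctr_permissible : ∀ s : State, s.WF → ∀ T ∈ s.Str, ¬ PrincipalAt s T → Permissible s (ctr s T)
  /-- the invariant is constant along the centre -/
  inv_ctr : ∀ s : State, s.WF → ∀ T ∈ s.Str, ¬ PrincipalAt s T → inv s (ctr s T) = inv s T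
  /-- coherence: nested point-types with the same invariant see the same centre -/
  coherent : ∀ s : State, s.WF → ∀ T ∈ s.Str, ∀ T' ∈ s.Str, ¬ PrincipalAt s T → T ⊆ T' →
    inv s T = inv s T' → ctr s T = ctr s T'
  /-- locality: strata away from the exceptional divisor keep their invariant and centre -/
  unchanged : ∀ s : State, s.WF → ∀ J ∈ s.Str, ∀ e ∉ s.B, ∀ T ∈ (move s J e 0).Str, e ∉ T →
    inv (move s J e 0) T = inv s T ∧ ctr (move s J e 0) T = ctr s T
  /-- drop: blowing up the centre of a MAXIMAL non-principal stratum, every new non-principal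
  stratum has strictly smaller invariant -/
  drop : ∀ s : State, s.WF → ∀ T₀ ∈ s.Str, ¬ PrincipalAt s T₀ →
    (∀ T ∈ s.Str, ¬ PrincipalAt s T → inv s T ≤ inv s T₀) →
    ∀ e ∉ s.B, ∀ T ∈ (move s (ctr s T₀) e 0).Str, e ∈ T →
      ¬ PrincipalAt (move s (ctr s T₀) e 0) T → inv (move s (ctr s T₀) e 0) T < inv s T₀

namespace InvariantPackage

variable {W : Type*} [LinearOrder W]

/-- [OURS] The non-principal strata of a state. -/
noncomputable def bad (s : State) : Finset (Finset ℕ) :=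
  open Classical in s.Str.filter fun T => ¬ PrincipalAt s T

/-- [OURS] Membership in `bad`. -/
theorem mem_bad_iff {s : State} {T : Finset ℕ} : T ∈ bad s ↔ T ∈ s.Str ∧ ¬ PrincipalAt s T := by
  classical
  unfold bad
  rw [Finset.mem_filter]

/-- [OURS] A state with no non-principal stratum is principal. -/
theorem principal_of_bad_eq_empty {s : State} (h : bad s = ∅) : Principal s := by
  intro T hT
  by_contra hP
  have : T ∈ bad s := mem_bad_iff.mpr ⟨hT, hP⟩
  rw [h] at this
  exact absurd this (Finset.notMem_empty _)

/-- [OURS] The centres of the maximal non-principal strata (those with `inv = M`). -/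
noncomputable def maxCentres (P : InvariantPackage W) (s : State) (M : W) : Finset (Finset ℕ) :=
  open Classical in ((bad s).filter fun T => P.inv s T = M).image (P.ctr s)

/-- [OURS] Membership in `maxCentres`. -/
theorem mem_maxCentres_iff (P : InvariantPackage W) {s : State} {M : W} {J : Finset ℕ} :
    J ∈ P.maxCentres s M ↔ ∃ T ∈ bad s, P.inv s T = M ∧ P.ctr s T = J := by
  classical
  unfold maxCentres
  simp only [Finset.mem_image, Finset.mem_filter]
  constructor
  · rintro ⟨T, ⟨hT, hM⟩, hJ⟩; exact ⟨T, hT, hM, hJ⟩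
  · rintro ⟨T, hT, hM, hJ⟩; exact ⟨T, ⟨hT, hM⟩, hJ⟩

/-- [OURS] A fresh index: one more than every live index. -/
def fresh (s : State) : ℕ := s.B.sup id + 1

/-- [OURS] The fresh index is not live. -/
theorem fresh_not_mem (s : State) : fresh s ∉ s.B := by
  intro h
  have h2 : id (fresh s) ≤ s.B.sup id := Finset.le_sup (f := id) h
  simp only [id, fresh] at h2
  omega

/-- [OURS] **The globalisation step.**  For a well-formed state whose non-principal strata have
maximal invariant `M` with `n` maximal centres, the game is winnable — by well-founded induction on
`(M, n)`: blow up the centre `J₀` of a maximal non-principal stratum; every new non-principal stratum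
has invariant `< M` (DROP), every surviving one keeps its invariant and centre (UNCHANGED) and its
centre is not `J₀` (it would contain `J₀` and have been subdivided), so either the maximum drops or the
set of maximal centres shrinks. -/
theorem winnable_aux [WellFoundedLT W] (P : InvariantPackage W) (M : W) :
    ∀ (n : ℕ) (s : State), s.WF → (hb : (bad s).Nonempty) →
      (bad s).sup' hb (P.inv s) = M → (P.maxCentres s M).card = n → Winnable 0 s := by
  induction M using WellFoundedLT.induction with
  | ind M ihM =>
    intro n
    induction n using Nat.strong_induction_on with
    | h n ihn =>
      intro s hs hb hM hn
      -- a maximal non-principal stratum `T₀` and its centre `J₀`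
      obtain ⟨T₀, hT₀bad, hT₀max⟩ := Finset.exists_mem_eq_sup' hb (P.inv s)
      rw [hM] at hT₀max
      obtain ⟨hT₀str, hT₀np⟩ := mem_bad_iff.mp hT₀bad
      have hle : ∀ T ∈ s.Str, ¬ PrincipalAt s T → P.inv s T ≤ M := by
        intro T hT hnp
        rw [← hM]
        exact Finset.le_sup' (P.inv s) (mem_bad_iff.mpr ⟨hT, hnp⟩)
      have hle' : ∀ T ∈ s.Str, ¬ PrincipalAt s T → P.inv s T ≤ P.inv s T₀ := by
        rw [← hT₀max]; exact hle
      set J₀ := P.ctr s T₀ with hJ₀def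
      have hJ₀perm : Permissible s J₀ := P.ctr_permissible s hs T₀ hT₀str hT₀np
      have hJ₀str : J₀ ∈ s.Str := hJ₀perm.1
      have hJ₀mem : J₀ ∈ P.maxCentres s M :=
        (P.mem_maxCentres_iff).mpr ⟨T₀, hT₀bad, hT₀max.symm, rfl⟩
      -- the move
      set e := fresh s with hedef
      have he : e ∉ s.B := fresh_not_mem s
      set s' := move s J₀ e 0 with hs'def
      have hs' : s'.WF := WF.move hs J₀ e 0
      refine Winnable.step J₀ e hJ₀perm he ?_
      -- analyse the new state
      by_cases hb' : (bad s').Nonempty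
      swap
      · exact Winnable.done (principal_of_bad_eq_empty (Finset.not_nonempty_iff_eq_empty.mp hb'))
      -- every new non-principal stratum has invariant ≤ M; those containing `e` have `< M`
      have hinv' : ∀ T ∈ bad s', (e ∈ T → P.inv s' T < M) ∧
          (e ∉ T → P.inv s' T = P.inv s T ∧ P.ctr s' T = P.ctr s T ∧ T ∈ bad s ∧ ¬ J₀ ⊆ T) := by
        intro T hT
        obtain ⟨hTstr, hTnp⟩ := mem_bad_iff.mp hT
        constructor
        · intro heT
          have := P.drop s hs T₀ hT₀str hT₀np hle' e he T hTstr heT hTnp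
          simp only [← hJ₀def, ← hs'def, ← hT₀max] at this ⊢
          exact this
        · intro heT
          obtain ⟨hTold, hJT⟩ := mem_str_of_mem_move_str_of_not_mem hTstr heT
          obtain ⟨h1, h2⟩ := P.unchanged s hs J₀ hJ₀str e he T hTstr heT
          refine ⟨h1, h2, mem_bad_iff.mpr ⟨hTold, ?_⟩, hJT⟩
          rwa [principalAt_move_iff heT] at hTnp
      have hM'le : (bad s').sup' hb' (P.inv s') ≤ M := by
        apply Finset.sup'_le
        intro T hT
        by_cases heT : e ∈ T
        · exact ((hinv' T hT).1 heT).le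
        · obtain ⟨h1, -, h3, -⟩ := (hinv' T hT).2 heT
          rw [h1]
          obtain ⟨hTold, hTnp⟩ := mem_bad_iff.mp h3
          exact hle T hTold hTnp
      rcases hM'le.lt_or_eq with hlt | heq
      · -- the maximum dropped
        exact ihM _ hlt _ s' hs' hb' rfl rfl
      · -- same maximum: the maximal centres are among the old ones, minus `J₀`
        have hsub : P.maxCentres s' M ⊆ (P.maxCentres s M).erase J₀ := by
          intro J hJ
          obtain ⟨T, hTbad, hTM, hTJ⟩ := (P.mem_maxCentres_iff).mp hJ
          have heT : e ∉ T := fun heT => (lt_irrefl M) (hTM ▸ (hinv' T hTbad).1 heT)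
          obtain ⟨h1, h2, h3, h4⟩ := (hinv' T hTbad).2 heT
          rw [Finset.mem_erase]
          refine ⟨?_, (P.mem_maxCentres_iff).mpr ⟨T, h3, h1 ▸ hTM, h2 ▸ hTJ⟩⟩
          -- `J ≠ J₀`: otherwise `J₀ = ctr s T ⊆ T`, but `T` survived, so `J₀ ⊄ T`
          rintro rfl
          obtain ⟨hTold, hTnp⟩ := mem_bad_iff.mp h3
          exact h4 ((h2 ▸ hTJ) ▸ P.ctr_subset s hs T hTold hTnp)
        have hcard : (P.maxCentres s' M).card < n := by
          calc (P.maxCentres s' M).card ≤ ((P.maxCentres s M).erase J₀).card := Finset.card_le_card hsub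
            _ < (P.maxCentres s M).card := Finset.card_erase_lt_of_mem hJ₀mem
            _ = n := hn
        exact ihn _ hcard s' hs' hb' heq rfl

/-- [OURS · W5.2 M2-strong] **Globalisation theorem**: an invariant package wins the global permissible
polyhedra game from every well-formed state. -/
theorem winnable [WellFoundedLT W] (P : InvariantPackage W) (s : State) (hs : s.WF) : Winnable 0 s := by
  by_cases hb : (bad s).Nonempty
  · exact P.winnable_aux _ _ s hs hb rfl rfl
  · exact Winnable.done (principal_of_bad_eq_empty (Finset.not_nonempty_iff_eq_empty.mp hb))

/-- [OURS · W5.2 M2-strong] Hence ANY invariant package discharges the target of file 1. -/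
theorem globalPermissiblePolyhedraGame [WellFoundedLT W] (P : InvariantPackage W) :
    GlobalPermissiblePolyhedraGame :=
  fun s hs => P.winnable s hs

end InvariantPackage

end PolyhedraGame

end Summit.ResolutionOfSingularities.ResolutionOfSingularities.Theorems
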